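import Summits.BirchSwinnertonDyer.Rank1Residual.Additive.X4RankZeroVisibleRefinedCertificate
import Summits.BirchSwinnertonDyer.Rank1Residual.Additive.X4RankZeroKatoParity
import HarnessLib

/-!
# The (G) visibility ENDs over the SHARP Kato reading: the Tamagawa binder relaxed to the READING
# `ord₃ ∏ c_ℓ = ord₃ c₃` and, by Cassels–Tate parity, to Tamagawa DEFECT `≤ 1`
# (cell `b2b-bsdres`, team n1011, row T-GSHARP FILE 1; seat p04 GEN 12; route planner 1 ST-51c
# "(U-TAM)", n1011-p09 GEN 13's T-D44-REC located gap)

HONEST FRAMING (cell `b2b-bsdres`, run/shared/lean/b2b/bsd-rank1-residual/, verbatim in every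
file): the goal of the cell is to DELETE the COMBINATION-SHAPED residual classes of the
Birch–Swinnerton-Dyer formula for ALL analytic-rank `≤ 1` elliptic curves over `ℚ` — "full BSD
formula for every rank `≤ 1` curve in class `C`" assembled STRICTLY from published theorems — so
that the rank-`≤ 1` remainder becomes exactly the CONSTRUCTION-SHAPED classes, which are TYPED
(missing-input `Prop`s), NOT attempted. This is not "finishing BSD". Team n1011 (N10 / N11, the
additive block X4 ∧ `p = 3`): research route on the CONSTRUCTION-SHAPED class X4; no claim beyond
the stated classes; nothing is booked; no mark / label / count is changed by this file. Theorems
only (no definition, no new named fact, no `sorry`). END theorems: CONDITIONAL on the displayed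
named facts (the SHARP Kato reading A161 `hKatoS`, Cassels–Tate `hCT`, Gross–Zagier–Kolyvagin `hGZK`,
modularity `hmod`, the Tate-uniformisation facts A40/A41 `hU`/`hU2`); they CLOSE NOTHING by
themselves — a per-row RECORD must discharge `θ`, the partner's rank budget `hT`, the bad-place list
`hS`, every disjunct of `hplaces` and the Tamagawa reading / defect `htam` in the kernel, and carries
`hr`, `hq`/`hv`/`hev` (`r_an`, `#Ш_an`) as EVIDENCE binders (ruling of record, n1011 lead R5-82 (d)).

## What

FILE 5 (`X4RankZeroVisibleRefinedCertificate.lean`) serves the potentially GOOD rows through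
`X4RankZero.bsdp_three_of_congr_of_places₇_of_kato`, whose upper half is the ORIGINAL Kato reading
`Kato2004.rankZero_padicValNat_sha_le_of_additive_potGood_of_imageContainsSL2` with its binder
`htam : ¬ 3 ∣ ∏ c_ℓ(E)`. On the rows with `3 ∣ ∏ c_ℓ(E)` (route planner 1, ROUTE-1 §41.5: 526 of the
3 565 potentially good N11 targets, 196 of them PASS; §51 ST-51c: 85 D44 + 18 D44-K (G) rows; p09's
T-D44-REC located gap: 90 rows) that END is unavailable and the rows are LOWER-ONLY. The SHARP reading
A161 `Kato2004.rankZero_padicValNat_sha_le_sub_localTamagawa_of_additive_potGood_of_imageContainsSL2`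
(Kato 2004 Thm. 14.5 (3) + Prop. 14.16 (2), local index by Kim 2026 §3.2.3: `ord₃ #Ш ≤
ord₃(L(E,1)/Ω) − v₃(c₃)`, NO Tamagawa hypothesis; the binder `hKatoS` the (M) records already
display) gives, with `d := ord₃ ∏ c_ℓ − ord₃ c₃` the Tamagawa DEFECT of the row (the `3`s in the
`c_ℓ`, `ℓ ≠ 3`):
* `d = 0` (the READING `ord₃ ∏ c_ℓ = ord₃ c₃`; every `c₃ = 3` Kodaira IV / IV* row whose other `c_ℓ`
  are prime to `3`): `ord₃ #Ш ≤ ord₃ #Ш_an` (additive-p4's `X4RankZero.missingUpperBoundAt_of_katoSharp`)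
  — with the visible lower bound `3² ∣ #Ш`, `ord₃ #Ш_an ≤ 2` this is `BSD(E,3)`:
  `X4RankZero.bsdp_three_of_congr_of_places₇_of_katoSharp`;
* `d ≤ 1`: `ord₃ #Ш ≤ ord₃ #Ш_an + 1`; `#Ш` is a square (Cassels–Tate), so if `ord₃ #Ш_an` is EVEN the
  `+ 1` drops (additive-p4's
  `X4RankZero.missingUpperBoundAt_of_katoSharp_of_casselsTate_of_tamDefect_le_one_of_even`) — with the
  visible lower bound this is `BSD(E,3)` under ONE extra EVIDENCE binder `hev : Even (ord₃ #Ш_an)`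
  (true on every BSD-consistent row: there `#Ш_an = #Ш` is a square):
  `X4RankZero.bsdp_three_of_congr_of_places₇_of_katoSharp_of_tamDefect_le_one`;
* `d ≥ 2`: sharp Kato + parity leave `ord₃ #Ш ∈ {ord₃ #Ш_an, ord₃ #Ш_an + 2}` — LOWER-ONLY, a located
  gap, not attempted here.
§1 states the two compositions at every odd `p` over the typed LOWER half (`MissingLowerBoundAt`,
any producer); §2 the two ENDs over the refined seven-kind certificate of T-2LL FILE 3 at `p = 3`
(binder list of FILE 5's (G) END token for token, with `hKato ↦ hKatoS`, `htam` retyped, and `hev`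
inserted after `hv` in the defect twin). The prime-list record sockets are FILE 2
(`X4RankZeroVisibleRefinedCertificateSharpSockets.lean`).

References: [Kato2004Asterisque] Thm. 14.5 (3) (p. 236), Prop. 14.16 (2) (p. 244); [Kim2022StructureSelmer]
§3.2.3; [SilvermanAEC2009] Thm. X.4.14 (Cassels–Tate); [CremonaMazur2000] §3 and Table 1;
[AgasheStein2002] Thm. 3.1; [Miller2011LMS] Def. 1.1; [SilvermanATAEC1994] Ch. V; cells/n1011/ROUTE-1.md
§41.5, §51 (ST-51c).
-/

set_option autoImplicit false

noncomputable section

open scoped Classical NumberField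
open IsDedekindDomain NumberField WeierstrassCurve
  Literature.NumberTheory.EllipticCurves Literature.NumberTheory.EllipticCurves.ModularForms
  Literature.NumberTheory.EllipticCurves.Rank1Residual
  Literature.NumberTheory.EllipticCurves.Rank1Residual.Typed
  Literature.NumberTheory.GaloisRepresentations
  Summit.BirchSwinnertonDyer.Rank1Residual.GaloisImage

namespace Summit.BirchSwinnertonDyer.Rank1Residual.Additive

/-! ### §1. The two compositions over the typed LOWER half, every odd `p` -/

section

variable (W : WeierstrassCurve ℚ) [W.IsElliptic] [W.IsGloballyMinimal] (p : ℕ) [Fact p.Prime]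

/-- **`BSD(E,p)` from the LOWER half on the Tamagawa-READING rows, SHARP Kato** (sharp twin of p03's
`X4RankZero.bsdp_of_missingLowerBoundAt_of_kato`, whose `htam : ¬ p ∣ ∏ c_ℓ` becomes the reading
`ord_p ∏ c_ℓ = ord_p c_p`): X4 ∧ `r_an = 0` ∧ `ord_p j ≥ 0` ∧ `ρ̄_{E,p^n}` onto for all `n` ∧ a datum `D`
with `p ∤ c_D` ∧ `ord_p ∏ c_ℓ = ord_p c_p` ∧ `MissingLowerBoundAt W p` ⟹ `BSD(E,p)` — upper half
`X4RankZero.missingUpperBoundAt_of_katoSharp`, whole `Typed.bsdp_of_missingPPartAt`.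
[cite: Kato2004Asterisque, Thm. 14.5 (3) (p. 236), Prop. 14.16 (2) (p. 244)] [cite: Miller2011LMS, §1 and Def. 1.1] -/
theorem X4RankZero.bsdp_of_missingLowerBoundAt_of_katoSharp
    (hKatoS : Kato2004.rankZero_padicValNat_sha_le_sub_localTamagawa_of_additive_potGood_of_imageContainsSL2)
    (hGZK : rank_eq_analyticRank_of_analyticRank_le_one) (hmod : hasEntireLFunction_rat)
    (hr : W.analyticRank = 0) (hX : ClassX4 W p) (hpot : 0 ≤ padicValRat p W.j)
    (hsurj : ∀ n : ℕ, W.HasSurjectiveModNGaloisRep (p ^ n : ℕ))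
    (htam : padicValNat p W.tamagawaProduct =
      padicValNat p ((W.baseChange ℚ_[p]).localTamagawaNumber ℤ_[p]))
    {N : ℕ} [NeZero N] (D : ModularParametrizationData W N) (hc : ¬ (p : ℤ) ∣ D.maninConstant)
    (hlow : MissingLowerBoundAt W p) : BSDp W p :=
  bsdp_of_missingPPartAt W p hGZK (by rw [hr]; exact zero_le_one)
    (missingPPartAt_of_lower_of_upper W p hlow
      (X4RankZero.missingUpperBoundAt_of_katoSharp W p hKatoS hGZK hmod hr hX hpot hsurj htam D hc))

/-- **`BSD(E,p)` from the LOWER half on the Tamagawa-DEFECT-ONE rows with `ord_p #Ш_an` EVEN, SHARP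
Kato + Cassels–Tate parity**: X4 ∧ `r_an = 0` ∧ `ord_p j ≥ 0` ∧ `ρ̄_{E,p^n}` onto for all `n` ∧ a
datum `D` with `p ∤ c_D` ∧ `ord_p ∏ c_ℓ ≤ ord_p c_p + 1` ∧ `#Ш_an = q` with `ord_p q` even ∧
`MissingLowerBoundAt W p` ⟹ `BSD(E,p)` — the sharp bound is `ord_p #Ш ≤ ord_p q + 1`, `#Ш` is a square
(`hCT`), so `ord_p #Ш ≤ ord_p q` (additive-p4's
`X4RankZero.missingUpperBoundAt_of_katoSharp_of_casselsTate_of_tamDefect_le_one_of_even`); whole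
`Typed.bsdp_of_missingPPartAt`. [cite: Kato2004Asterisque, Thm. 14.5 (3) (p. 236), Prop. 14.16 (2) (p. 244)]
[cite: SilvermanAEC2009, Thm. X.4.14] [cite: Miller2011LMS, §1 and Def. 1.1] -/
theorem X4RankZero.bsdp_of_missingLowerBoundAt_of_katoSharp_of_casselsTate_of_tamDefect_le_one
    (hCT : exists_casselsTate_pairing (K := ℚ))
    (hKatoS : Kato2004.rankZero_padicValNat_sha_le_sub_localTamagawa_of_additive_potGood_of_imageContainsSL2)
    (hGZK : rank_eq_analyticRank_of_analyticRank_le_one) (hmod : hasEntireLFunction_rat)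
    (hr : W.analyticRank = 0) (hX : ClassX4 W p) (hpot : 0 ≤ padicValRat p W.j)
    (hsurj : ∀ n : ℕ, W.HasSurjectiveModNGaloisRep (p ^ n : ℕ))
    (htam : padicValNat p W.tamagawaProduct ≤
      padicValNat p ((W.baseChange ℚ_[p]).localTamagawaNumber ℤ_[p]) + 1)
    {N : ℕ} [NeZero N] (D : ModularParametrizationData W N) (hc : ¬ (p : ℤ) ∣ D.maninConstant)
    {q : ℚ} (hq : shaAn W = (q : ℂ)) (hev : Even (padicValRat p q))
    (hlow : MissingLowerBoundAt W p) : BSDp W p :=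
  bsdp_of_missingPPartAt W p hGZK (by rw [hr]; exact zero_le_one)
    (missingPPartAt_of_lower_of_upper W p hlow
      (X4RankZero.missingUpperBoundAt_of_katoSharp_of_casselsTate_of_tamDefect_le_one_of_even W p hCT
        hKatoS hGZK hmod hr hX hpot hsurj D hc htam hq hev))

end

/-! ### §2. The two ENDs over the refined seven-kind certificate at `p = 3` -/

/-- **X4 ∧ `r = 0`, potentially GOOD at `3`, Tamagawa READING `ord₃ ∏ c_ℓ = ord₃ c₃`, `ord₃ #Ш_an ≤ 2`:
`BSD(E,3)` from the SHARP Kato UPPER half and a VISIBLE element of `Ш(E)[3]` from the REFINED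
seven-kind certificate** — FILE 5's `X4RankZero.bsdp_three_of_congr_of_places₇_of_kato` with the
sharp reading `hKatoS` for `hKato` and the reading `ord₃ ∏ c_ℓ = ord₃ c₃` for `¬ 3 ∣ ∏ c_ℓ` (so the
`c₃ = 3` rows — Kodaira IV / IV* at `3` — are served): pay `#E′(ℚ_w)[3]·#(ℤ_w/3)` on `T` against
`hT` (`< 3^{rank E′}`), every place of `S ∖ T` free of kind (i), (ii), (iii), (iv′), (vi), (iii′) or
(vii); lower half `Visible.missingLowerBoundAt_three_of_congr_of_places₇` (T-2LL FILE 3), upper half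
and whole §1. Conditional on `hKatoS`, `hCT`, `hGZK`, `hmod`, `hU`, `hU2`; closes nothing until a record
discharges the certificate and the reading. [cite: CremonaMazur2000, §3 and Table 1]
[cite: AgasheStein2002, Thm. 3.1] [cite: Kato2004Asterisque, Thm. 14.5 (3) (p. 236), Prop. 14.16 (2) (p. 244)]
[cite: SilvermanAEC2009, Thm. X.4.14] -/
theorem X4RankZero.bsdp_three_of_congr_of_places₇_of_katoSharp
    (hKatoS : Kato2004.rankZero_padicValNat_sha_le_sub_localTamagawa_of_additive_potGood_of_imageContainsSL2)
    (hCT : exists_casselsTate_pairing (K := ℚ))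
    (hGZK : rank_eq_analyticRank_of_analyticRank_le_one) (hmod : hasEntireLFunction_rat)
    (W : WeierstrassCurve ℚ) [W.IsElliptic] [W.IsGloballyMinimal]
    (hr : W.analyticRank = 0) (hX : haveI : Fact (Nat.Prime 3) := ⟨Nat.prime_three⟩; ClassX4 W 3)
    (hpot : 0 ≤ padicValRat 3 W.j)
    (hsurj : ∀ n : ℕ, W.HasSurjectiveModNGaloisRep (3 ^ n : ℕ))
    (htam : haveI : Fact (Nat.Prime 3) := ⟨Nat.prime_three⟩
      padicValNat 3 W.tamagawaProduct =
        padicValNat 3 ((W.baseChange ℚ_[3]).localTamagawaNumber ℤ_[3]))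
    {N : ℕ} [NeZero N] (D : ModularParametrizationData W N) (hc : ¬ (3 : ℤ) ∣ D.maninConstant)
    {q : ℚ} (hq : shaAn W = (q : ℂ)) (hv : padicValRat 3 q ≤ 2)
    (hU : Silverman1994_thmV53_tateUniformisation.{0})
    (hU2 : Silverman1994_thmV53_corV54_tateUniformisation.{0})
    (W' : WeierstrassCurve ℚ) [W'.IsElliptic]
    (θ : geomTorsion W' ((3 : ℕ) : ℤ) ≃+ geomTorsion W ((3 : ℕ) : ℤ))
    (hθ : ∀ (σ : Field.absoluteGaloisGroup ℚ) (P : geomTorsion W' ((3 : ℕ) : ℤ)),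
      θ (σ • P) = σ • θ P)
    (S T : Finset (HeightOneSpectrum (𝓞 ℚ))) (hTS : T ⊆ S)
    (hS : ∀ w : HeightOneSpectrum (𝓞 ℚ), w ∉ S →
      W.HasGoodReductionAt w ∧ W'.HasGoodReductionAt w ∧ ((3 : ℕ) : 𝓞 ℚ) ∉ w.asIdeal)
    (hT : (∏ w ∈ T, Nat.card (nsmulAddMonoidHom 3 :
        (W'.baseChange (w.adicCompletion ℚ)).toAffine.Point →+ _).ker *
        Nat.card (w.adicCompletionIntegers ℚ ⧸
          Ideal.span {((3 : ℕ) : w.adicCompletionIntegers ℚ)})) < 3 ^ W'.mordellWeilRank)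
    (hplaces : ∀ w ∈ S, w ∉ T →
      (((3 : ℕ) : 𝓞 ℚ) ∉ w.asIdeal ∧ Nat.card (nsmulAddMonoidHom 3 :
          (W'.baseChange (w.adicCompletion ℚ)).toAffine.Point →+ _).ker = 1) ∨
      (W.HasSplitMultiplicativeReductionAt w ∧ W'.HasSplitMultiplicativeReductionAt w ∧
        Nat.card (nsmulAddMonoidHom 3 :
          (W.baseChange (w.adicCompletion ℚ)).toAffine.Point →+ _).ker ≤ 3) ∨
      (W.HasMultiplicativeReductionAt w ∧ W'.HasMultiplicativeReductionAt w ∧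
        (∃ r : w.adicCompletion ℚ, algebraMap ℚ (w.adicCompletion ℚ) (-(W.c₄ / W.c₆)) =
          r ^ 2 * algebraMap ℚ (w.adicCompletion ℚ) (-(W'.c₄ / W'.c₆))) ∧
        (∀ ζ : w.adicCompletion ℚ, ζ ^ 3 = 1 → ζ = 1)) ∨
      (W.HasMultiplicativeReductionAt w ∧
        ¬ IsSquare (algebraMap ℚ (w.adicCompletion ℚ) (-(W.c₄ / W.c₆))) ∧
        W'.HasGoodReductionAt w ∧ ((3 : ℕ) : 𝓞 ℚ) ∉ w.asIdeal) ∨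
      (W.HasGoodReductionAt w ∧ W'.HasMultiplicativeReductionAt w ∧
        ¬ IsSquare (algebraMap ℚ (w.adicCompletion ℚ) (-(W'.c₄ / W'.c₆))) ∧
        ((3 : ℕ) : 𝓞 ℚ) ∉ w.asIdeal) ∨
      (1 < w.valuation ℚ W.j ∧ 1 < w.valuation ℚ W'.j ∧
        (∃ r : w.adicCompletion ℚ, algebraMap ℚ (w.adicCompletion ℚ) (-(W.c₄ / W.c₆)) =
          r ^ 2 * algebraMap ℚ (w.adicCompletion ℚ) (-(W'.c₄ / W'.c₆))) ∧
        (∀ ζ : w.adicCompletion ℚ, ζ ^ 3 = 1 → ζ = 1)) ∨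
      (W.HasAdditiveReductionAt w ∧ W'.HasAdditiveReductionAt w ∧ ((3 : ℕ) : 𝓞 ℚ) ∉ w.asIdeal ∧
        Nat.card (nsmulAddMonoidHom 3 :
          (W'.baseChange (w.adicCompletion ℚ)).toAffine.Point →+ _).ker = 3)) :
    haveI : Fact (Nat.Prime 3) := ⟨Nat.prime_three⟩
    BSDp W 3 := by
  haveI : Fact (Nat.Prime 3) := ⟨Nat.prime_three⟩
  have hfin : Finite W.toAffine.Point := finite_point_of_analyticRank_eq_zero W hGZK hr
  have hSha : W.ShaFinite := (hGZK W (by rw [hr]; exact zero_le_one)).2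
  have hirr : Irr W 3 :=
    hasIrreducibleModPGaloisRep_of_hasSurjectiveModNGaloisRep W 3 (by simpa using hsurj 1)
  have hlow : MissingLowerBoundAt W 3 :=
    Visible.missingLowerBoundAt_three_of_congr_of_places₇ hU hU2 hCT W W' θ hθ S T hTS hS hfin
      (coprime_natCard_point_of_irr W 3 hirr) hT hplaces hSha hq hv
  exact X4RankZero.bsdp_of_missingLowerBoundAt_of_katoSharp W 3 hKatoS hGZK hmod hr hX hpot hsurj htam
    D hc hlow

/-- **X4 ∧ `r = 0`, potentially GOOD at `3`, Tamagawa DEFECT `≤ 1` (`ord₃ ∏ c_ℓ ≤ ord₃ c₃ + 1`),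
`ord₃ #Ш_an ≤ 2` and EVEN: `BSD(E,3)` from the SHARP Kato UPPER half, Cassels–Tate parity, and a
VISIBLE element of `Ш(E)[3]` from the REFINED seven-kind certificate** — as
`X4RankZero.bsdp_three_of_congr_of_places₇_of_katoSharp` with the reading relaxed to defect `≤ 1` at
the price of ONE extra EVIDENCE binder `hev : Even (ord₃ q)` (`#Ш_an = q`): the sharp bound reads
`ord₃ #Ш ≤ ord₃ q + 1`, `#Ш` is a square, so `ord₃ #Ш ≤ ord₃ q`; with the visible `3² ∣ #Ш` and
`ord₃ q ≤ 2`, `ord₃ #Ш = 2 = ord₃ q`. Lower half `Visible.missingLowerBoundAt_three_of_congr_of_places₇`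
(T-2LL FILE 3), upper half and whole §1. Conditional on `hKatoS`, `hCT`, `hGZK`, `hmod`, `hU`, `hU2`;
closes nothing until a record discharges the certificate and the defect. [cite: CremonaMazur2000, §3 and Table 1]
[cite: AgasheStein2002, Thm. 3.1] [cite: Kato2004Asterisque, Thm. 14.5 (3) (p. 236), Prop. 14.16 (2) (p. 244)]
[cite: SilvermanAEC2009, Thm. X.4.14] -/
theorem X4RankZero.bsdp_three_of_congr_of_places₇_of_katoSharp_of_tamDefect_le_one
    (hKatoS : Kato2004.rankZero_padicValNat_sha_le_sub_localTamagawa_of_additive_potGood_of_imageContainsSL2)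
    (hCT : exists_casselsTate_pairing (K := ℚ))
    (hGZK : rank_eq_analyticRank_of_analyticRank_le_one) (hmod : hasEntireLFunction_rat)
    (W : WeierstrassCurve ℚ) [W.IsElliptic] [W.IsGloballyMinimal]
    (hr : W.analyticRank = 0) (hX : haveI : Fact (Nat.Prime 3) := ⟨Nat.prime_three⟩; ClassX4 W 3)
    (hpot : 0 ≤ padicValRat 3 W.j)
    (hsurj : ∀ n : ℕ, W.HasSurjectiveModNGaloisRep (3 ^ n : ℕ))
    (htam : haveI : Fact (Nat.Prime 3) := ⟨Nat.prime_three⟩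
      padicValNat 3 W.tamagawaProduct ≤
        padicValNat 3 ((W.baseChange ℚ_[3]).localTamagawaNumber ℤ_[3]) + 1)
    {N : ℕ} [NeZero N] (D : ModularParametrizationData W N) (hc : ¬ (3 : ℤ) ∣ D.maninConstant)
    {q : ℚ} (hq : shaAn W = (q : ℂ)) (hv : padicValRat 3 q ≤ 2) (hev : Even (padicValRat 3 q))
    (hU : Silverman1994_thmV53_tateUniformisation.{0})
    (hU2 : Silverman1994_thmV53_corV54_tateUniformisation.{0})
    (W' : WeierstrassCurve ℚ) [W'.IsElliptic]
    (θ : geomTorsion W' ((3 : ℕ) : ℤ) ≃+ geomTorsion W ((3 : ℕ) : ℤ))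
    (hθ : ∀ (σ : Field.absoluteGaloisGroup ℚ) (P : geomTorsion W' ((3 : ℕ) : ℤ)),
      θ (σ • P) = σ • θ P)
    (S T : Finset (HeightOneSpectrum (𝓞 ℚ))) (hTS : T ⊆ S)
    (hS : ∀ w : HeightOneSpectrum (𝓞 ℚ), w ∉ S →
      W.HasGoodReductionAt w ∧ W'.HasGoodReductionAt w ∧ ((3 : ℕ) : 𝓞 ℚ) ∉ w.asIdeal)
    (hT : (∏ w ∈ T, Nat.card (nsmulAddMonoidHom 3 :
        (W'.baseChange (w.adicCompletion ℚ)).toAffine.Point →+ _).ker *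
        Nat.card (w.adicCompletionIntegers ℚ ⧸
          Ideal.span {((3 : ℕ) : w.adicCompletionIntegers ℚ)})) < 3 ^ W'.mordellWeilRank)
    (hplaces : ∀ w ∈ S, w ∉ T →
      (((3 : ℕ) : 𝓞 ℚ) ∉ w.asIdeal ∧ Nat.card (nsmulAddMonoidHom 3 :
          (W'.baseChange (w.adicCompletion ℚ)).toAffine.Point →+ _).ker = 1) ∨
      (W.HasSplitMultiplicativeReductionAt w ∧ W'.HasSplitMultiplicativeReductionAt w ∧
        Nat.card (nsmulAddMonoidHom 3 :
          (W.baseChange (w.adicCompletion ℚ)).toAffine.Point →+ _).ker ≤ 3) ∨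
      (W.HasMultiplicativeReductionAt w ∧ W'.HasMultiplicativeReductionAt w ∧
        (∃ r : w.adicCompletion ℚ, algebraMap ℚ (w.adicCompletion ℚ) (-(W.c₄ / W.c₆)) =
          r ^ 2 * algebraMap ℚ (w.adicCompletion ℚ) (-(W'.c₄ / W'.c₆))) ∧
        (∀ ζ : w.adicCompletion ℚ, ζ ^ 3 = 1 → ζ = 1)) ∨
      (W.HasMultiplicativeReductionAt w ∧
        ¬ IsSquare (algebraMap ℚ (w.adicCompletion ℚ) (-(W.c₄ / W.c₆))) ∧
        W'.HasGoodReductionAt w ∧ ((3 : ℕ) : 𝓞 ℚ) ∉ w.asIdeal) ∨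
      (W.HasGoodReductionAt w ∧ W'.HasMultiplicativeReductionAt w ∧
        ¬ IsSquare (algebraMap ℚ (w.adicCompletion ℚ) (-(W'.c₄ / W'.c₆))) ∧
        ((3 : ℕ) : 𝓞 ℚ) ∉ w.asIdeal) ∨
      (1 < w.valuation ℚ W.j ∧ 1 < w.valuation ℚ W'.j ∧
        (∃ r : w.adicCompletion ℚ, algebraMap ℚ (w.adicCompletion ℚ) (-(W.c₄ / W.c₆)) =
          r ^ 2 * algebraMap ℚ (w.adicCompletion ℚ) (-(W'.c₄ / W'.c₆))) ∧
        (∀ ζ : w.adicCompletion ℚ, ζ ^ 3 = 1 → ζ = 1)) ∨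
      (W.HasAdditiveReductionAt w ∧ W'.HasAdditiveReductionAt w ∧ ((3 : ℕ) : 𝓞 ℚ) ∉ w.asIdeal ∧
        Nat.card (nsmulAddMonoidHom 3 :
          (W'.baseChange (w.adicCompletion ℚ)).toAffine.Point →+ _).ker = 3)) :
    haveI : Fact (Nat.Prime 3) := ⟨Nat.prime_three⟩
    BSDp W 3 := by
  haveI : Fact (Nat.Prime 3) := ⟨Nat.prime_three⟩
  have hfin : Finite W.toAffine.Point := finite_point_of_analyticRank_eq_zero W hGZK hr
  have hSha : W.ShaFinite := (hGZK W (by rw [hr]; exact zero_le_one)).2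
  have hirr : Irr W 3 :=
    hasIrreducibleModPGaloisRep_of_hasSurjectiveModNGaloisRep W 3 (by simpa using hsurj 1)
  have hlow : MissingLowerBoundAt W 3 :=
    Visible.missingLowerBoundAt_three_of_congr_of_places₇ hU hU2 hCT W W' θ hθ S T hTS hS hfin
      (coprime_natCard_point_of_irr W 3 hirr) hT hplaces hSha hq hv
  exact X4RankZero.bsdp_of_missingLowerBoundAt_of_katoSharp_of_casselsTate_of_tamDefect_le_one W 3 hCT
    hKatoS hGZK hmod hr hX hpot hsurj htam D hc hq hev hlow

end Summit.BirchSwinnertonDyer.Rank1Residual.Additive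

end
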